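import Mathlib
import HarnessLib
import HarnessLib.Audit
import Summits.CriticalPhenomena.PercolationContinuityZ3.Theorems.PercNearOneGluingNoHeavyLowerTailHexMSMatchPureSCTight

/-!
# The second-order Marica–Schönheim inequality (MS2): statement, the tight case, and (MS2) ⟹ (Π2″) for dead-like blocks (hp-7 gen 72)

Support file for crux `stmt-CriticalPhenomena-4575` (route `PercNearOneGluingNoHeavy`), hull-port seat `prim-hp-7` (generation 72);
`--supports stmt-CriticalPhenomena-4575`.  No `sorry`.  Memo: `run/shared/lean/prim/prim-hp-7/FROM-prim-hp-7-g72-MS2.md` §0.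

* `MS2 α` — **Conjecture (MS2), second-order Marica–Schönheim** (gen 72; an obligation `def … : Prop`, never asserted).  For a two-coloured
  family `F = P ⊔ Q` and families `D₅ ⊆ P \\ Q`, `D₂ ⊆ Q \\ P` of PURE cross differences (no element of `D₅ ∪ D₂` is a difference of two
  members of the same block):  `#(F ∪ D₅ ∪ D₂) ≤ #(F \\ F ∪ P \\ D₅ ∪ Q \\ D₂)`.  `D₅ = D₂ = ∅` is Marica–Schönheim.  Exact by SAT on `2^[3]`,
  `2^[4]` (all families; kit `j253579`), by exhaustion on `2^[4]` for `#F ≤ 4`, and in `2·10⁵` random trials on `2^[5]`, `2^[6]`; each hypothesis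
  is necessary, and the analogues with three colour classes or with per-difference (non-global) colourings are false (memo §0 (B)).
* `card_le_card_secondDiff_of_tight` — **(MS2) holds when `F` is MS-tight and no member of `F` is a difference of two members** (e.g. `F`
  pairwise intersecting), from the tight core `card_le_card_filter_secondDiff_of_pivot` (`…HexMSMatchSecondDiff`).
* `two_mul_card_le_card_clU_scTerms_of_ms2` — **(MS2) ⟹ (Π2″) for dead-like blocks** (pairwise intersecting, non-covering `F = P ⊔ Q`, `W`
  complement-free representatives avoiding `cl(P \\ P ∪ Q \\ Q)`): `2 (#P + #Q + #W) ≤ #clU U (scTerms P Q W)`.  THE SECOND-DIFFERENCE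
  REDUCTION: with `D₅ = W ∩ (P \\ Q)` (type 5, `w = p \ q`) and `D₂ = {d ∈ Q \\ P : U \ d ∈ W}` (type 2, `w = p ∪ (U \ q)`, `U \ w = q \ p`) only the
  terms `p \ d ∈ P \\ W` and `q \ d = q ∩ w ∈ Q ⊼ W` are used; all of `F \\ F ∪ P \\ D₅ ∪ Q \\ D₂` lies below members, so (non-covering) it is
  disjoint from its complements and `#clU` doubles it.  With `card_le_card_farNbhd_of_tight_or_free`'s proof pattern (`…HexMSMatchDepthOneTight`)
  this makes (MS2) the official pure target for the whole depth-one layer of (MATCH*).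
-/

namespace Summit.CriticalPhenomena.PercolationContinuityZ3.Theorems

namespace GeneratedDonors

open Finset FinsetFamily

variable {α : Type*} [DecidableEq α]

section MS2

/-- **Conjecture (MS2)** (hp-7 gen 72), the second-order Marica–Schönheim inequality.  An obligation, not a fact. -/
def MS2 (α : Type*) [DecidableEq α] : Prop :=
  ∀ (P Q D₅ D₂ : Finset (Finset α)), Disjoint P Q → D₅ ⊆ P \\ Q → D₂ ⊆ Q \\ P →
    (∀ d ∈ D₅ ∪ D₂, d ∉ (P \\ P) ∪ (Q \\ Q)) →
    #((P ∪ Q) ∪ D₅ ∪ D₂) ≤ #(((P ∪ Q) \\ (P ∪ Q)) ∪ (P \\ D₅) ∪ (Q \\ D₂))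

/-- **(MS2) in the Marica–Schönheim-tight case** (no member a difference of members): from the pivot-fibre core. -/
theorem card_le_card_secondDiff_of_tight (P Q D₅ D₂ : Finset (Finset α))
    (hD₅ : D₅ ⊆ P \\ Q) (hD₂ : D₂ ⊆ Q \\ P) (hpure : ∀ d ∈ D₅ ∪ D₂, d ∉ (P \\ P) ∪ (Q \\ Q))
    (htight : #((P ∪ Q) \\ (P ∪ Q)) = #(P ∪ Q)) (hmem : ∀ f ∈ P ∪ Q, f ∉ (P ∪ Q) \\ (P ∪ Q)) :
    #((P ∪ Q) ∪ D₅ ∪ D₂) ≤ #(((P ∪ Q) \\ (P ∪ Q)) ∪ (P \\ D₅) ∪ (Q \\ D₂)) := by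
  classical
  set F := P ∪ Q with hFdef
  set D := D₅ ∪ D₂ with hDdef
  have hDsub : D ⊆ F \\ F := by
    intro d hd
    rcases mem_union.mp hd with hd | hd
    · obtain ⟨a, ha, b, hb, rfl⟩ := mem_diffs.mp (hD₅ hd)
      exact mem_diffs.mpr ⟨a, mem_union_left _ ha, b, mem_union_right _ hb, rfl⟩
    · obtain ⟨a, ha, b, hb, rfl⟩ := mem_diffs.mp (hD₂ hd)
      exact mem_diffs.mpr ⟨a, mem_union_right _ ha, b, mem_union_left _ hb, rfl⟩
  -- trivial bound: #(F ∪ D) ≤ #F + #D and the differences alone give #F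
  have hMS : #F ≤ #(F \\ F) := F.card_le_card_diffs
  rcases F.eq_empty_or_nonempty with hF0 | hne
  · -- F = ∅ forces D = ∅
    have hD0 : D = ∅ := by
      rw [eq_empty_iff_forall_notMem]
      intro d hd
      have := hDsub hd
      rw [hF0] at this
      simp at this
    have h1 : (P ∪ Q) ∪ D₅ ∪ D₂ = F ∪ D := by rw [hDdef, union_assoc]
    rw [h1, hD0, hF0]; simp
  obtain ⟨c, hcF, hc⟩ := TwistedAD.exists_pivot_of_card_diffs_eq_card F htight hne
  set Tm := F.filter fun m => ∃ d ∈ D, (∃ p ∈ P, p \ d = m) ∧ (∃ q ∈ Q, q \ d = m) with hTmdef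
  have hcore : #D ≤ #Tm :=
    card_le_card_filter_secondDiff_of_pivot rfl htight.le hc hcF hDsub
      (fun d hd h => hpure d hd (mem_union_left _ h)) (fun d hd h => hpure d hd (mem_union_right _ h))
  -- the witnesses are second differences of the right block, and are not first differences
  have hTmT : Tm ⊆ (P \\ D₅) ∪ (Q \\ D₂) := by
    intro m hm
    obtain ⟨-, d, hdD, ⟨p, hp, hpd⟩, ⟨q, hq, hqd⟩⟩ := mem_filter.mp hm
    rcases mem_union.mp hdD with hd | hd
    · exact mem_union_left _ (mem_diffs.mpr ⟨p, hp, d, hd, hpd⟩)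
    · exact mem_union_right _ (mem_diffs.mpr ⟨q, hq, d, hd, hqd⟩)
  have hdisj : Disjoint (F \\ F) Tm := by
    rw [Finset.disjoint_right]
    intro m hm
    exact hmem m (mem_filter.mp hm).1
  have hsub : (F \\ F) ∪ Tm ⊆ (F \\ F) ∪ (P \\ D₅) ∪ (Q \\ D₂) := by
    rw [union_assoc]; exact union_subset_union (subset_refl _) hTmT
  have h1 : (P ∪ Q) ∪ D₅ ∪ D₂ = F ∪ D := by rw [hDdef, union_assoc]
  rw [h1]
  calc #(F ∪ D) ≤ #F + #D := card_union_le _ _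
    _ ≤ #(F \\ F) + #Tm := Nat.add_le_add hMS hcore
    _ = #((F \\ F) ∪ Tm) := (card_union_of_disjoint hdisj).symm
    _ ≤ #((F \\ F) ∪ (P \\ D₅) ∪ (Q \\ D₂)) := card_le_card hsub

end MS2

section Reduction

variable {U : Finset α}

/-- **The second-difference reduction: (MS2) ⟹ (Π2″) for dead-like blocks.** -/
theorem two_mul_card_le_card_clU_scTerms_of_ms2 (hMS2 : MS2 α) (P Q W : Finset (Finset α))
    (hU : ∀ a ∈ P ∪ Q, a ⊆ U) (hPQ : Disjoint P Q)
    (hint : ∀ a ∈ P ∪ Q, ∀ b ∈ P ∪ Q, (a ∩ b).Nonempty) (hcov : ∀ a ∈ P ∪ Q, ∀ b ∈ P ∪ Q, a ∪ b ≠ U)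
    (hrep : W ⊆ scReps U P Q) (hWco : ∀ a ∈ W, ∀ b ∈ W, a ≠ U \ b)
    (hC2 : ∀ w ∈ W, w ∉ clU U ((P \\ P) ∪ (Q \\ Q))) :
    2 * (#P + #Q + #W) ≤ #(clU U (scTerms P Q W)) := by
  classical
  set F := P ∪ Q with hFdef
  set T := scTerms P Q W with hTdef
  have hcardF : #F = #P + #Q := card_union_of_disjoint hPQ
  have hP : ∀ {a}, a ∈ P → a ∈ F := fun ha => mem_union_left _ ha
  have hQ : ∀ {a}, a ∈ Q → a ∈ F := fun ha => mem_union_right _ ha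
  have hcc : ∀ {a : Finset α}, a ⊆ U → U \ (U \ a) = a := fun ha => Finset.sdiff_sdiff_eq_self ha
  have hWU : ∀ w ∈ W, w ⊆ U := fun w hw => subset_of_mem_scReps hU (hrep hw)
  -- the pure cross differences behind W
  set D₅ : Finset (Finset α) := (P \\ Q).filter fun d => d ∈ W with hD₅def
  set D₂ : Finset (Finset α) := (Q \\ P).filter fun d => U \ d ∈ W with hD₂def
  have hD₅ : D₅ ⊆ P \\ Q := filter_subset _ _
  have hD₂ : D₂ ⊆ Q \\ P := filter_subset _ _
  have hdsubU : ∀ t ∈ (P \\ P) ∪ (Q \\ Q), t ⊆ U := by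
    intro t ht
    rcases mem_union.mp ht with ht | ht
    · obtain ⟨a, ha, b, -, rfl⟩ := mem_diffs.mp ht; exact sdiff_subset.trans (hU a (hP ha))
    · obtain ⟨a, ha, b, -, rfl⟩ := mem_diffs.mp ht; exact sdiff_subset.trans (hU a (hQ ha))
  have hpure : ∀ d ∈ D₅ ∪ D₂, d ∉ (P \\ P) ∪ (Q \\ Q) := by
    intro d hd hbad
    rcases mem_union.mp hd with hd | hd
    · exact hC2 d (mem_filter.mp hd).2 (mem_clU.mpr (Or.inl hbad))
    · exact hC2 _ (mem_filter.mp hd).2 (mem_clU.mpr (Or.inr ⟨d, hbad, rfl⟩))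
  -- members are neither cross differences nor their own kind: F, D₅, D₂ pairwise disjoint
  have hFD : ∀ d ∈ D₅ ∪ D₂, d ∉ F := by
    intro d hd hdF
    have : d ∈ F \\ F := by
      rcases mem_union.mp hd with hd | hd
      · obtain ⟨a, ha, b, hb, rfl⟩ := mem_diffs.mp (hD₅ hd); exact sdiff_mem_diffs (hP ha) (hQ hb)
      · obtain ⟨a, ha, b, hb, rfl⟩ := mem_diffs.mp (hD₂ hd); exact sdiff_mem_diffs (hQ ha) (hP hb)
    exact notMem_clU_diffs_of_mem hU hint hcov hdF (mem_clU.mpr (Or.inl this))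
  have h52 : Disjoint D₅ D₂ := by
    rw [Finset.disjoint_left]
    intro d h5 h2
    have hw : d ∈ W := (mem_filter.mp h5).2
    have hw' : U \ d ∈ W := (mem_filter.mp h2).2
    exact hWco _ hw' _ hw rfl
  -- #W ≤ #D₅ + #D₂ : w ↦ (w if w ∈ P \\ Q else U \ w)
  have hWD : #W ≤ #(D₅ ∪ D₂) := by
    refine card_le_card_of_injOn (fun w => if w ∈ P \\ Q then w else U \ w) ?_ ?_
    · intro w hw
      have hw' := hrep (mem_coe.mp hw)
      simp only [mem_coe]
      by_cases hwd : w ∈ P \\ Q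
      · rw [if_pos hwd]; exact mem_union_left _ (mem_filter.mpr ⟨hwd, mem_coe.mp hw⟩)
      · rw [if_neg hwd]
        unfold scReps at hw'
        rcases mem_union.mp hw' with h | h
        · exact absurd h hwd
        · obtain ⟨pq, hpq, hpqw⟩ := mem_image.mp h
          obtain ⟨hp₀, hq₀⟩ := mem_product.mp hpq
          have hq₀U : pq.2 ⊆ U := hU _ (hQ hq₀)
          have he_eq : U \ w = pq.2 \ pq.1 := by
            rw [← hpqw]
            ext i; simp only [mem_sdiff, mem_union]
            constructor
            · rintro ⟨hiU, h⟩
              refine ⟨?_, fun h1 => h (Or.inl h1)⟩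
              by_contra h2; exact h (Or.inr ⟨hiU, h2⟩)
            · rintro ⟨hi2, hi1⟩
              exact ⟨hq₀U hi2, fun h => h.elim hi1 (fun h' => h'.2 hi2)⟩
          refine mem_union_right _ (mem_filter.mpr ⟨?_, ?_⟩)
          · rw [he_eq]; exact sdiff_mem_diffs hq₀ hp₀
          · rw [hcc (hWU w (mem_coe.mp hw))]; exact mem_coe.mp hw
    · intro w hw w' hw' hww
      simp only at hww
      have hwU := hWU w (mem_coe.mp hw); have hw'U := hWU w' (mem_coe.mp hw')
      by_cases h1 : w ∈ P \\ Q <;> by_cases h2 : w' ∈ P \\ Q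
      · rwa [if_pos h1, if_pos h2] at hww
      · rw [if_pos h1, if_neg h2] at hww
        exact absurd hww (hWco w (mem_coe.mp hw) w' (mem_coe.mp hw'))
      · rw [if_neg h1, if_pos h2] at hww
        exact absurd hww.symm (hWco w' (mem_coe.mp hw') w (mem_coe.mp hw))
      · rw [if_neg h1, if_neg h2] at hww
        rw [← hcc hwU, hww, hcc hw'U]
  -- (MS2)
  have hms2 := hMS2 P Q D₅ D₂ hPQ hD₅ hD₂ hpure
  set T₀ := (F \\ F) ∪ (P \\ D₅) ∪ (Q \\ D₂) with hT₀def
  have hcount : #F + #W ≤ #T₀ := by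
    have hFD' : Disjoint F (D₅ ∪ D₂) := Finset.disjoint_right.mpr fun d hd => hFD d hd
    have e1 : #(F ∪ D₅ ∪ D₂) = #F + (#D₅ + #D₂) := by
      rw [union_assoc, card_union_of_disjoint hFD', card_union_of_disjoint h52]
    have e2 : #(D₅ ∪ D₂) = #D₅ + #D₂ := card_union_of_disjoint h52
    have := hms2
    rw [e1] at this
    omega
  -- T₀ ⊆ T, below members, hence disjoint from its complements
  have hT₀T : T₀ ⊆ T := by
    intro t ht
    rw [hTdef]; unfold scTerms; simp only [mem_union]
    rcases mem_union.mp ht with ht | ht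
    · rcases mem_union.mp ht with ht | ht
      · obtain ⟨a, ha, b, hb, rfl⟩ := mem_diffs.mp ht
        rcases mem_union.mp ha with ha | ha <;> rcases mem_union.mp hb with hb | hb
        · exact Or.inl (Or.inl (Or.inl (Or.inl (Or.inl (Or.inl (Or.inl (sdiff_mem_diffs ha hb)))))))
        · exact Or.inl (Or.inl (Or.inl (Or.inl (Or.inl (Or.inr (sdiff_mem_diffs ha hb))))))
        · exact Or.inl (Or.inl (Or.inl (Or.inl (Or.inr (sdiff_mem_diffs ha hb)))))
        · exact Or.inl (Or.inl (Or.inl (Or.inl (Or.inl (Or.inl (Or.inr (sdiff_mem_diffs ha hb)))))))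
      · obtain ⟨p, hp, d, hd, rfl⟩ := mem_diffs.mp ht
        exact Or.inl (Or.inl (Or.inl (Or.inr (mem_diffs.mpr ⟨p, hp, d, (mem_filter.mp hd).2, rfl⟩))))
    · obtain ⟨q, hq, d, hd, rfl⟩ := mem_diffs.mp ht
      refine Or.inl (Or.inr (mem_infs.mpr ⟨q, hq, U \ d, (mem_filter.mp hd).2, ?_⟩))
      show q ∩ (U \ d) = q \ d
      ext i; simp only [mem_inter, mem_sdiff]
      constructor
      · rintro ⟨hiq, -, hid⟩; exact ⟨hiq, hid⟩
      · rintro ⟨hiq, hid⟩; exact ⟨hiq, hU q (hQ hq) hiq, hid⟩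
  have hbelow : ∀ t ∈ T₀, ∃ f ∈ F, t ⊆ f := by
    intro t ht
    rcases mem_union.mp ht with ht | ht
    · rcases mem_union.mp ht with ht | ht
      · obtain ⟨a, ha, b, -, rfl⟩ := mem_diffs.mp ht; exact ⟨a, ha, sdiff_subset⟩
      · obtain ⟨p, hp, d, -, rfl⟩ := mem_diffs.mp ht; exact ⟨p, hP hp, sdiff_subset⟩
    · obtain ⟨q, hq, d, -, rfl⟩ := mem_diffs.mp ht; exact ⟨q, hQ hq, sdiff_subset⟩
  set Tc := T₀.image fun t => U \ t with hTcdef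
  have hcardTc : #Tc = #T₀ := by
    refine card_image_of_injOn ?_
    intro t ht t' ht' htt
    obtain ⟨f, hf, htf⟩ := hbelow t (mem_coe.mp ht)
    obtain ⟨f', hf', htf'⟩ := hbelow t' (mem_coe.mp ht')
    simp only at htt
    rw [← hcc (htf.trans (hU f hf)), htt, hcc (htf'.trans (hU f' hf'))]
  have hdisj : Disjoint T₀ Tc := by
    rw [Finset.disjoint_left]
    intro t ht htc
    obtain ⟨t', ht', htt⟩ := mem_image.mp htc
    obtain ⟨f, hf, htf⟩ := hbelow t ht
    obtain ⟨f', hf', htf'⟩ := hbelow t' ht'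
    apply hcov f hf f' hf'
    apply Subset.antisymm (union_subset (hU f hf) (hU f' hf'))
    intro i hiU
    rw [mem_union]
    by_cases hif' : i ∈ t'
    · exact Or.inr (htf' hif')
    · have : i ∈ U \ t' := mem_sdiff.mpr ⟨hiU, hif'⟩
      rw [htt] at this
      exact Or.inl (htf this)
  have hbig : T₀ ∪ Tc ⊆ clU U T := by
    intro t ht
    rcases mem_union.mp ht with ht | ht
    · exact mem_clU.mpr (Or.inl (hT₀T ht))
    · obtain ⟨t', ht', rfl⟩ := mem_image.mp ht
      exact mem_clU.mpr (Or.inr ⟨t', hT₀T ht', rfl⟩)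
  have := card_le_card hbig
  rw [card_union_of_disjoint hdisj, hcardTc] at this
  omega

end Reduction

end GeneratedDonors

end Summit.CriticalPhenomena.PercolationContinuityZ3.Theorems
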